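import Literature.NumberTheory.EllipticCurves.IwasawaSelmerDualProofs
import Literature.NumberTheory.EllipticCurves.H1UnramifiedFinite
import HarnessLib

/-!
# Descent of torsion-valued continuous cocycles along a FINITE (possibly wild) layer:
# elementary corestriction + divisibility of `H¹(G, M[p^∞])` — row T-CG-W file F3a
# (cell `b2b-bsdres`, team n1011; seat n1011-p05 GEN 10)

HONEST FRAMING (cell `b2b-bsdres`, run/shared/lean/b2b/bsd-rank1-residual/, verbatim in every
file): the goal of the cell is to DELETE the COMBINATION-SHAPED residual classes of the
Birch–Swinnerton-Dyer formula for ALL analytic-rank `≤ 1` elliptic curves over `ℚ` — "full BSD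
formula for every rank `≤ 1` curve in class `C`" assembled STRICTLY from published theorems — so
that the rank-`≤ 1` remainder becomes exactly the CONSTRUCTION-SHAPED classes, which are TYPED
(missing-input `Prop`s), NOT attempted. This is not "finishing BSD". Team n1011 / class O6 of
RESIDUAL-MAP §I (WILD potentially supersingular additive `3`): research route; ABSTRACT TOOL
theorems of continuous group cohomology (no curve, no field); 0 definitions, 0 named facts;
nothing booked, no mark moves, closes nothing.

## Why

S1 (`Additive/GoodModelNoLocalCondition`) descends "no local condition at `v` over `K_∞`" from a
level fixing the good supersingular model by PRIME-TO-`p` corestriction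
(`TameDescent.strictKer_le_localKerOver_kerSubgroup_of_index_coprime`, p05 F2). On class O6
(`p = 3`, Kodaira II/IV/IV*/II*) the model-fixing layer is WILD. The printed descent ([CoGr] §4
Props. 4.3/4.8 as quoted by Coates, LNM 1716 p. 32; Greenberg LNM 1716 pp. 74–75, 84, 105) uses
`cd_p(G_{(F_∞)_η}) = 1` in the form "`H¹((F_∞)_η, E[p^∞])` is divisible" (Greenberg p. 105 with
Lemma 4.5). This file isolates the group-cohomological mechanism, with the divisibility as an
explicit hypothesis `hdiv`.

## What (ABSTRACT: a topological group `G`, a discrete `G`-module `M`, a prime `p`, the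
`p`-primary torsion `M[p^∞] = AddCommGroup.primaryComponent M p` with its induced `G`-action)

* `Descent.exists_index_nsmul_eq_smul_sub` — ELEMENTARY CORESTRICTION: a crossed homomorphism
  `φ : G → M` vanishing on a subgroup `N` of finite index satisfies `[G : N] • φ = ∂b`,
  `b = −Σ_{q ∈ G/N} φ(q.out)` (Serre, *Galois Cohomology* I.§2.4: `cor ∘ res = [G : N]`, here on
  cocycles trivial on `N`; pure algebra, no topology, no normality).
* `Descent.exists_sub_pow_smul_eq_smul_sub` — if `H¹(G, M[p^∞])` is `p`-divisible, a
  torsion-valued continuous crossed homomorphism `F` is `p^s F' + ∂m` with `F'` torsion-valued.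
* **`Descent.exists_eq_smul_sub_of_divisible_of_level`** — THE DESCENT for COMPACT `G`: if
  `H¹(G, M[p^∞])` is `p`-divisible (`hdiv`) and torsion-valued continuous crossed homomorphisms
  are principal ON a finite-index subgroup `N` (`hlevel`), they are principal on `G`:
  `[F] = p^s [F']`, `s = [G : N]`; `F' − ∂a₁` vanishes on `N` so `s [F'] = 0`; `p^{k'} [F'] = 0`
  (compactness: `IwasawaDual.exists_pow_smul_oneCocycleClass_eq_zero`); `gcd(s, p^{k'}) ∣ p^s`
  (`p^t ≤ s < p^s`); hence `[F] = 0`. No normality and NO coprimality of `[G : N]` to `p`.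
* `Descent.exists_eq_smul_sub_of_coprime_of_level` (APPEND, addendum A2) — the COPRIME-INDEX form:
  no `hdiv`, `[G : N]` prime to `p` (`gcd([G:N], p^{k'}) = 1`): the cocycle form of the
  prime-to-`p` restriction/corestriction descent.

Consumer: `Additive/GoodModelNoLocalConditionDescent.lean` (F3b: `G = (ker κ)_v`,
`M = E(K̄_v)`, `N = G ∩ Gal(K̄_v/M₁)`).

References: J.-P. Serre, *Galois Cohomology* I.§2.4 [SerreGaloisCohomology1997]; R. Greenberg,
LNM 1716 (1999) §2 pp. 74–75, §4 p. 105 (Lemma 4.5) [GreenbergLNM1716]; J. Coates, LNM 1716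
pp. 31–32; [CoatesGreenberg1996] §4 Props. 4.3, 4.8; skeleton `cells/n1011/skel/T-CG-W.md`.
-/

noncomputable section

open scoped Classical

universe u

namespace Summit.BirchSwinnertonDyer.Rank1Residual.GaloisImage

open Literature.NumberTheory.EllipticCurves Literature.NumberTheory.GaloisRepresentations

/-! ## §1 Elementary corestriction: the index kills cocycles trivial on a finite-index subgroup -/

namespace Descent

section Algebra

variable {G : Type*} [Group G] {M : Type*} [AddCommGroup M] [DistribMulAction G M]

/-- A crossed homomorphism vanishing on a subgroup `N` is constant on the left cosets `gN`.
[folklore] -/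
theorem apply_mul_eq_of_forall_mem (N : Subgroup G) (φ : G → M)
    (hcoc : ∀ g h, φ (g * h) = φ g + g • φ h) (hφ : ∀ n ∈ N, φ n = 0) (g : G) {n : G}
    (hn : n ∈ N) : φ (g * n) = φ g := by
  rw [hcoc g n, hφ n hn, smul_zero, add_zero]

/-- **Elementary corestriction.** If a crossed homomorphism `φ : G → M` (`φ(gh) = φ(g) + g•φ(h)`)
vanishes on a subgroup `N` of finite index, then `[G : N] • φ` is principal:
`[G : N] • φ(g) = g • b − b` with `b = −Σ_{q ∈ G/N} φ(q.out)` — summing the cocycle identity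
`φ(g q) = φ(g) + g • φ(q)` over coset representatives `q` and reindexing `q ↦ g q`
(`φ` is constant on left cosets). This is `cor ∘ res = [G : N]` on the classes that die on `N`.
[cite: SerreGaloisCohomology1997, I.§2.4 (res, cor; cor ∘ res = index)] -/
theorem exists_index_nsmul_eq_smul_sub (N : Subgroup G) [Finite (G ⧸ N)] (φ : G → M)
    (hcoc : ∀ g h, φ (g * h) = φ g + g • φ h) (hφ : ∀ n ∈ N, φ n = 0) :
    ∃ b : M, ∀ g : G, Nat.card (G ⧸ N) • φ g = g • b - b := by
  letI : Fintype (G ⧸ N) := Fintype.ofFinite _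
  set b₀ : M := ∑ q : G ⧸ N, φ q.out with hb₀
  refine ⟨-b₀, fun g ↦ ?_⟩
  -- `φ (g * q.out) = φ ((g • q).out)`: both lie in the left coset `g • q`
  have hcoset : ∀ q : G ⧸ N, φ (g * q.out) = φ ((g • q : G ⧸ N).out) := by
    intro q
    have h1 : (QuotientGroup.mk (g * q.out) : G ⧸ N) = g • q := by
      conv_rhs => rw [← QuotientGroup.out_eq' q]
      rfl
    have h2 : ((g • q : G ⧸ N).out)⁻¹ * (g * q.out) ∈ N := by
      rw [← QuotientGroup.eq, QuotientGroup.out_eq', h1]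
    have h3 : g * q.out = (g • q : G ⧸ N).out * (((g • q : G ⧸ N).out)⁻¹ * (g * q.out)) := by
      rw [mul_inv_cancel_left]
    rw [h3, apply_mul_eq_of_forall_mem N φ hcoc hφ _ h2]
  -- sum of the cocycle identity over `q`
  have hsum : ∑ q : G ⧸ N, φ (g * q.out) = Fintype.card (G ⧸ N) • φ g + g • b₀ := by
    have : ∀ q : G ⧸ N, φ (g * q.out) = φ g + g • φ q.out := fun q ↦ hcoc g q.out
    simp_rw [this, Finset.sum_add_distrib, Finset.sum_const, Finset.card_univ, hb₀,
      Finset.smul_sum]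
  -- reindexing `q ↦ g • q`
  have hreindex : ∑ q : G ⧸ N, φ (g * q.out) = b₀ := by
    simp_rw [hcoset]
    rw [hb₀]
    exact Fintype.sum_equiv (MulAction.toPerm g) _ _ fun q ↦ rfl
  rw [Nat.card_eq_fintype_card]
  have key : Fintype.card (G ⧸ N) • φ g + g • b₀ = b₀ := hsum.symm.trans hreindex
  rw [smul_neg, sub_neg_eq_add]
  calc Fintype.card (G ⧸ N) • φ g = Fintype.card (G ⧸ N) • φ g + g • b₀ + -(g • b₀) := by abel
    _ = b₀ + -(g • b₀) := by rw [key]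
    _ = -(g • b₀) + b₀ := by abel

/-- Iterating divisibility by `p`: divisibility by `p ^ n`. [folklore] -/
theorem exists_eq_pow_smul_of_forall_exists_eq_smul {A : Type*} [AddCommGroup A] {p : ℕ}
    (hdiv : ∀ c : A, ∃ c' : A, c = p • c') (n : ℕ) (c : A) : ∃ c' : A, c = p ^ n • c' := by
  induction n generalizing c with
  | zero => exact ⟨c, by rw [pow_zero, one_smul]⟩
  | succ n ih =>
    obtain ⟨c₁, rfl⟩ := hdiv c
    obtain ⟨c₂, rfl⟩ := ih c₁
    exact ⟨c₂, by rw [pow_succ', mul_smul]⟩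

/-- `gcd` bookkeeping: if `d ∣ N` (`N > 0`) and `d ∣ p ^ k`, then `d ∣ p ^ N`
(`d = p ^ t` with `p ^ t ≤ N < p ^ N`). [folklore] -/
theorem dvd_pow_of_dvd_of_dvd_pow {p : ℕ} (hp' : p.Prime) {d N k : ℕ} (hN : 0 < N)
    (hdN : d ∣ N) (hdk : d ∣ p ^ k) : d ∣ p ^ N := by
  obtain ⟨t, -, rfl⟩ := (Nat.dvd_prime_pow hp').mp hdk
  refine Nat.pow_dvd_pow p (le_of_lt ?_)
  have h1 : p ^ t ≤ N := Nat.le_of_dvd hN hdN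
  have h2 : N < p ^ N := Nat.lt_pow_self hp'.one_lt
  exact (Nat.pow_lt_pow_iff_right hp'.one_lt).mp (lt_of_le_of_lt h1 h2)

/-- In an additive commutative group: if `a • x = 0` and `b • x = 0` then `gcd a b • x = 0`
(Bézout). [folklore] -/
theorem gcd_nsmul_eq_zero {A : Type*} [AddCommGroup A] {a b : ℕ} {x : A} (ha : a • x = 0)
    (hb : b • x = 0) : Nat.gcd a b • x = 0 := by
  have h : ((Nat.gcd a b : ℕ) : ℤ) • x = 0 := by
    rw [Nat.gcd_eq_gcd_ab a b, add_smul, mul_comm (a : ℤ), mul_comm (b : ℤ), mul_smul, mul_smul,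
      natCast_zsmul, natCast_zsmul, ha, hb, smul_zero, smul_zero, add_zero]
  rwa [natCast_zsmul] at h

end Algebra

section Topological

variable {G : Type u} [Group G] [TopologicalSpace G] [IsTopologicalGroup G]
  {M : Type u} [AddCommGroup M] [DistribMulAction G M] [TopologicalSpace M] [DiscreteTopology M]
  {p : ℕ} [hp : Fact p.Prime]

omit hp in
/-- **Divisibility step.** If every class of `H¹(G, M[p^∞])` is divisible by `p`, then a continuous
crossed homomorphism `F : G → M` with `p`-power-torsion values differs from `p^s` times another
such crossed homomorphism `F'` by a principal one: `F − p^s F' = ∂m` (lift `F` to `M[p^∞]`,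
divide its class by `p^s`, push the quotient back to `M`). [folklore] -/
theorem exists_sub_pow_smul_eq_smul_sub (s : ℕ)
    (hdiv : ∀ c : discreteH1 G (AddCommGroup.primaryComponent M p), ∃ c', c = p • c')
    (F : contOneCocycles (discreteTopRep G M)) (hF : ∀ g, ∃ k : ℕ, p ^ k • F.1 g = 0) :
    ∃ F' : contOneCocycles (discreteTopRep G M), (∀ g, ∃ k : ℕ, p ^ k • F'.1 g = 0) ∧
      ∃ m : M, ∀ g, F.1 g - p ^ s • F'.1 g = g • m - m := by
  -- the `M[p^∞]`-valued lift of `F`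
  have hFT_mem : ∀ g, F.1 g ∈ AddCommGroup.primaryComponent M p := fun g ↦
    (AddCommGroup.mem_primaryComponent).mpr (hF g)
  let FTfun : C(G, AddCommGroup.primaryComponent M p) :=
    ⟨fun g ↦ ⟨F.1 g, hFT_mem g⟩, F.1.continuous.subtype_mk _⟩
  have hFTcoc : FTfun ∈ contOneCocycles (discreteTopRep G (AddCommGroup.primaryComponent M p)) := by
    intro g h
    apply Subtype.ext
    change F.1 (g * h) = F.1 g + ((g • (⟨F.1 h, hFT_mem h⟩ : AddCommGroup.primaryComponent M p) :
      AddCommGroup.primaryComponent M p) : M)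
    rw [F.2 g h]
    rfl
  obtain ⟨ξ', hξ'⟩ := exists_eq_pow_smul_of_forall_exists_eq_smul hdiv s
    (oneCocycleClass _ ⟨FTfun, hFTcoc⟩)
  obtain ⟨F', hF'⟩ := oneCocycleClass_surjective _ ξ'
  have hcob : oneCocycleClass (discreteTopRep G (AddCommGroup.primaryComponent M p))
      (⟨FTfun, hFTcoc⟩ - ((p ^ s : ℕ) : ℤ) • F') = 0 := by
    rw [oneCocycleClass_sub, oneCocycleClass_smul, hF', hξ', Nat.cast_smul_eq_nsmul]
    exact sub_self _
  obtain ⟨m, hm⟩ := (oneCocycleClass_eq_zero_iff _ _).mp hcob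
  -- push `F'` forward along `M[p^∞] ↪ M`
  let F'M : contOneCocycles (discreteTopRep G M) :=
    contOneCocycles.pullback (ContinuousMonoidHom.id G)
      (resHomOfEquivariant (ContinuousMonoidHom.id G) (AddCommGroup.primaryComponent M p).subtype
        fun _ _ ↦ rfl) F'
  have hF'M : ∀ g, F'M.1 g = ((F'.1 g : AddCommGroup.primaryComponent M p) : M) := fun _ ↦ rfl
  refine ⟨F'M, fun g ↦ ?_, (m : M), fun g ↦ ?_⟩
  · obtain ⟨k, hk⟩ := (AddCommGroup.mem_primaryComponent).mp (F'.1 g).2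
    exact ⟨k, by rw [hF'M]; exact hk⟩
  · have h := congrArg (fun t : AddCommGroup.primaryComponent M p ↦ (t : M)) (hm g)
    have hl : ((((⟨FTfun, hFTcoc⟩ - ((p ^ s : ℕ) : ℤ) • F' :
        contOneCocycles (discreteTopRep G (AddCommGroup.primaryComponent M p))).1 g :
          AddCommGroup.primaryComponent M p) : M)) = F.1 g - p ^ s • F'M.1 g := by
      rw [Submodule.coe_sub, Submodule.coe_smul, ContinuousMap.sub_apply, ContinuousMap.smul_apply,
        Nat.cast_smul_eq_nsmul, AddSubgroupClass.coe_sub, AddSubgroupClass.coe_nsmul, hF'M]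
      rfl
    rw [hl] at h
    rw [h]
    rfl

/-- A crossed homomorphism that is principal pointwise has zero class (packaging of
`oneCocycleClass_eq_zero_iff` for integer multiples). [folklore] -/
theorem nsmul_oneCocycleClass_eq_zero_of_forall (n : ℕ) (F : contOneCocycles (discreteTopRep G M))
    (b : M) (hb : ∀ g, n • F.1 g = g • b - b) :
    n • oneCocycleClass (discreteTopRep G M) F = 0 := by
  have h := oneCocycleClass_smul (discreteTopRep G M) ((n : ℕ) : ℤ) F
  rw [← Nat.cast_smul_eq_nsmul ℤ n (oneCocycleClass (discreteTopRep G M) F), ← h,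
    oneCocycleClass_eq_zero_iff]
  refine ⟨b, fun g ↦ ?_⟩
  have h1 : ((((n : ℕ) : ℤ) • F : contOneCocycles (discreteTopRep G M)).1 g) = n • F.1 g := by
    rw [Submodule.coe_smul, ContinuousMap.smul_apply, Nat.cast_smul_eq_nsmul]
  rw [h1, hb g]
  rfl

/-- **The descent (abstract form).** Let `G` be a COMPACT topological group acting on a discrete
module `M`, `p` a prime, `N ≤ G` a subgroup of finite index (no normality, no coprimality of the
index to `p`). Assume: (`hdiv`) every class of `H¹(G, M[p^∞])` is divisible by `p`; (`hlevel`)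
every continuous crossed homomorphism `G → M` with `p`-power-torsion values is principal ON `N`.
Then every continuous crossed homomorphism `F : G → M` with `p`-power-torsion values is principal:
`[F] = p^s [F']` with `s = [G : N]` (`exists_sub_pow_smul_eq_smul_sub`); `F' − ∂a₁` vanishes on
`N`, so `s [F'] = 0` (`exists_index_nsmul_eq_smul_sub`); `p^{k'} [F'] = 0` (compactness,
`IwasawaDual.exists_pow_smul_oneCocycleClass_eq_zero`); `gcd(s, p^{k'}) ∣ p^s`; so `[F] = 0`.
This is the descent step of [CoGr] §4 Props. 4.3/4.8 (as quoted by Coates, LNM 1716 p. 32) with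
`cd_p ≤ 1` entering only through `hdiv`.
[cite: GreenbergLNM1716, §2 pp. 74–75 and §4 p. 105 (Lemma 4.5)] [cite: SerreGaloisCohomology1997, I.§2.4] -/
theorem exists_eq_smul_sub_of_divisible_of_level [CompactSpace G] (N : Subgroup G)
    [Finite (G ⧸ N)]
    (hdiv : ∀ c : discreteH1 G (AddCommGroup.primaryComponent M p), ∃ c', c = p • c')
    (hlevel : ∀ F' : contOneCocycles (discreteTopRep G M), (∀ g, ∃ k : ℕ, p ^ k • F'.1 g = 0) →
      ∃ a₁ : M, ∀ g ∈ N, F'.1 g = g • a₁ - a₁)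
    (F : contOneCocycles (discreteTopRep G M)) (hF : ∀ g, ∃ k : ℕ, p ^ k • F.1 g = 0) :
    ∃ a : M, ∀ g, F.1 g = g • a - a := by
  have hs_pos : 0 < Nat.card (G ⧸ N) := Nat.card_pos
  obtain ⟨F', hF'tors, m, hm⟩ := exists_sub_pow_smul_eq_smul_sub (Nat.card (G ⧸ N)) hdiv F hF
  obtain ⟨a₁, ha₁⟩ := hlevel F' hF'tors
  -- `[G : N] • [F'] = 0`
  obtain ⟨b, hb⟩ := exists_index_nsmul_eq_smul_sub N (fun g ↦ F'.1 g - (g • a₁ - a₁))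
    (fun g h ↦ by
      rw [F'.2 g h, discreteTopRep_ρ_apply, mul_smul, smul_sub, smul_sub]
      abel)
    (fun n hn ↦ by rw [ha₁ n hn, sub_self])
  have hs : Nat.card (G ⧸ N) • oneCocycleClass (discreteTopRep G M) F' = 0 := by
    refine nsmul_oneCocycleClass_eq_zero_of_forall _ F' (b + Nat.card (G ⧸ N) • a₁) fun g ↦ ?_
    have hb' := hb g
    rw [smul_sub, sub_eq_iff_eq_add] at hb'
    rw [hb', smul_add, smul_sub, smul_comm (Nat.card (G ⧸ N)) g a₁]
    abel
  -- `p ^ k' • [F'] = 0`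
  obtain ⟨k', hk'⟩ := IwasawaDual.exists_pow_smul_oneCocycleClass_eq_zero (p := p) F' hF'tors
  -- `gcd ∣ p ^ [G : N]`, so `p ^ [G : N] • [F'] = 0`
  have hgcd := gcd_nsmul_eq_zero hs hk'
  obtain ⟨e, he⟩ := dvd_pow_of_dvd_of_dvd_pow hp.out hs_pos (Nat.gcd_dvd_left _ _)
    (Nat.gcd_dvd_right _ _)
  have hps : p ^ Nat.card (G ⧸ N) • oneCocycleClass (discreteTopRep G M) F' = 0 := by
    rw [he, mul_comm, mul_smul, hgcd, smul_zero]
  -- `[F] = p ^ [G : N] • [F'] = 0`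
  have hF0 : oneCocycleClass (discreteTopRep G M) F = 0 := by
    have h0 : oneCocycleClass (discreteTopRep G M) (F - ((p ^ Nat.card (G ⧸ N) : ℕ) : ℤ) • F') = 0 := by
      rw [oneCocycleClass_eq_zero_iff]
      refine ⟨m, fun g ↦ ?_⟩
      have h1 : ((F - ((p ^ Nat.card (G ⧸ N) : ℕ) : ℤ) • F' :
          contOneCocycles (discreteTopRep G M)).1 g) = F.1 g - p ^ Nat.card (G ⧸ N) • F'.1 g := by
        rw [Submodule.coe_sub, Submodule.coe_smul, ContinuousMap.sub_apply, ContinuousMap.smul_apply,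
          Nat.cast_smul_eq_nsmul]
      rw [h1, hm g]
      rfl
    rw [oneCocycleClass_sub, oneCocycleClass_smul, sub_eq_zero, Nat.cast_smul_eq_nsmul, hps] at h0
    exact h0
  obtain ⟨a, ha⟩ := (oneCocycleClass_eq_zero_iff _ _).mp hF0
  exact ⟨a, fun g ↦ ha g⟩


omit hp in
/-- **The descent, COPRIME INDEX form (no divisibility hypothesis).** Let `G` be a COMPACT
topological group acting on a discrete module `M`, `p` a prime, `N ≤ G` a subgroup of finite
index PRIME TO `p`. If torsion-valued continuous crossed homomorphisms `G → M` are principal ON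
`N` (`hlevel`), they are principal on `G`: `F − ∂a₁` vanishes on `N`, so `[G : N] • [F] = 0`
(elementary corestriction `exists_index_nsmul_eq_smul_sub`); `p^{k'} • [F] = 0` (compactness);
`gcd([G : N], p^{k'}) = 1`. This is the cocycle form of the prime-to-`p` corestriction descent
(`res : H¹(G, ·)[p^∞] → H¹(N, ·)` injective when `p ∤ [G : N]`), the local counterpart of the
global `TameDescent.strictKer_le_localKerOver_kerSubgroup_of_index_coprime` (team n1011, p05 F2).
[cite: SerreGaloisCohomology1997, I.§2.4 (res, cor; cor ∘ res = index)] -/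
theorem exists_eq_smul_sub_of_coprime_of_level [CompactSpace G] (N : Subgroup G)
    [Finite (G ⧸ N)] (hcop : (Nat.card (G ⧸ N)).Coprime p)
    (hlevel : ∀ F' : contOneCocycles (discreteTopRep G M), (∀ g, ∃ k : ℕ, p ^ k • F'.1 g = 0) →
      ∃ a₁ : M, ∀ g ∈ N, F'.1 g = g • a₁ - a₁)
    (F : contOneCocycles (discreteTopRep G M)) (hF : ∀ g, ∃ k : ℕ, p ^ k • F.1 g = 0) :
    ∃ a : M, ∀ g, F.1 g = g • a - a := by
  obtain ⟨a₁, ha₁⟩ := hlevel F hF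
  -- `[G : N] • [F] = 0`
  obtain ⟨b, hb⟩ := exists_index_nsmul_eq_smul_sub N (fun g ↦ F.1 g - (g • a₁ - a₁))
    (fun g h ↦ by
      rw [F.2 g h, discreteTopRep_ρ_apply, mul_smul, smul_sub, smul_sub]
      abel)
    (fun n hn ↦ by rw [ha₁ n hn, sub_self])
  have hs : Nat.card (G ⧸ N) • oneCocycleClass (discreteTopRep G M) F = 0 := by
    refine nsmul_oneCocycleClass_eq_zero_of_forall _ F (b + Nat.card (G ⧸ N) • a₁) fun g ↦ ?_
    have hb' := hb g
    rw [smul_sub, sub_eq_iff_eq_add] at hb'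
    rw [hb', smul_add, smul_sub, smul_comm (Nat.card (G ⧸ N)) g a₁]
    abel
  -- `p ^ k' • [F] = 0`
  obtain ⟨k', hk'⟩ := IwasawaDual.exists_pow_smul_oneCocycleClass_eq_zero (p := p) F hF
  -- `gcd = 1`
  have hgcd := gcd_nsmul_eq_zero hs hk'
  rw [(Nat.Coprime.pow_right k' hcop : Nat.Coprime _ _), one_smul] at hgcd
  obtain ⟨a, ha⟩ := (oneCocycleClass_eq_zero_iff _ _).mp hgcd
  exact ⟨a, fun g ↦ ha g⟩

end Topological

end Descent

end Summit.BirchSwinnertonDyer.Rank1Residual.GaloisImage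

end
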